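import Summits.HodgeConjecture.HodgeConjecture.Theorems.MarkmanPartnerTransportPicardThreeK3SquaresRMTypeDescent
import HarnessLib

/-!
# Route MarkmanPartnerTransport · cruxes `PicardThreeK3Squares` ∕ `LowPicardRealMultiplication` — the `σ = id`
# corollary of RM-TYPE DESCENT: «(D)(θ_{S,t}) ⇒ HC⁴(S × S)», one hypothesis per surface

Cell hodge-nonav, planner p1 g36 (PICK 2, NEXT-2, 2026-08-28T09:43:06Z), prover seat 20241-p1 (g12). SUPPORT FILE
(`--supports stmt-HodgeConjecture-19652`, helper): CONDITIONAL on `Buskin2019_hodgeIsometry_algebraic`,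
`Huybrechts_K3_periodSurjective_projective` and the displayed `RMTypeDominated θ`; credits nothing; nothing here
says HC is proved.

`RMTypeDescent.hodgeConjectureFor_square_of_rmTypeDominated` (W3-T) takes a rational isometry `σ ∈ O(Λ_ℚ)`
conjugating the generator `t` of `End_Hdg T(S)` (in the marking `η`) to a model endomorphism `θ`. With `σ = id`
the model is the rational matrix `θ_{S,t,η}` of `η ∘ t ∘ η⁻¹` ITSELF:

* `exists_ratMatrix_marking_conj` — for a marked K3 surface and a rational endomorphism `t` of `H²` there is a
  (unique) rational matrix `θ` with `η (t c) = θ_ℂ (η c)` (`exists_ratEnd_of_forall_intCast`, the marking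
  identifies the rational classes with `Λ_ℚ`);
* `hodgeConjectureFor_square_of_rmTypeDominated_self` — for an RM K3 surface `S` marked by `(η, p, x)` with
  admissible SELF-ADJOINT generator `t` and `η ∘ t = θ_ℂ ∘ η`: `RMTypeDominated θ ⇒ HodgeConjectureFor 4 (S ⊗ S)`
  (W3-T with `σ = id`; the self-adjointness of `θ` is that of `t` read through the marking).

So the rows M-θ of INDEX v46 instantiate at any RM K3 surface without choosing `σ`, and the K3 side of cruxes #4∕#5
reads «(D)(θ_{S,t}) ⇒ HC⁴(S ⊗ S)» as a one-hypothesis statement per surface.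

References: van Geemen–Schütt, Forum Math. Sigma 13 (2025) e2, §2.1, §3.4; Buskin, J. reine angew. Math. 755
(2019), Thm. 1.1; Huybrechts, *Lectures on K3 Surfaces*, Ch. 6 Rem. 3.3, Ch. 7 Thm. 4.1.
-/

set_option linter.dupNamespace false

noncomputable section

namespace Summit.HodgeConjecture.HodgeConjecture.Theorems.MarkmanPartnerTransport.RMTypeDescent

open CategoryTheory MonoidalCategory Polynomial
open Literature.AlgebraicGeometry Literature.AlgebraicGeometry.Motives Literature.AlgebraicGeometry.HodgeTheory
open Literature.AlgebraicGeometry.Surfaces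
open Literature.AlgebraicTopology.SingularHomology
open Summit.HodgeConjecture.HodgeConjecture.Theorems.NikulinTwinTransport

/-- `MarkedK3[S, η, p, x]`: VERBATIM the `let MarkedK3 := …` binder of the route declaration
`PicardThreeK3Squares` (as in `…RMTypeDescent`). Local notation only. -/
local notation3 (prettyPrint := false) "MarkedK3[" S ", " η ", " p ", " x "]" =>
  (p ≠ 0 ∧ (IsIntegralClass p ∧
    (∀ q : complexBetti S (2 * 2), IsIntegralClass q → ∃ n : ℤ, q = n • p) ∧
    (∀ c : complexBetti S (2 * 1), IsIntegralClass c ↔ ∃ v : K3Index → ℤ, η c = fun i => (v i : ℂ)) ∧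
    (∀ a b : complexBetti S (2 * 1),
      cupProduct (rfl : 2 * 1 + 2 * 1 = 2 * 2) a b = k3Form (η a) (η b) • p) ∧
    IsOfHodgeType 2 S (2 * 1) 2 0 (LinearEquiv.symm η x) ∧
    (∀ τ : complexBetti S (2 * 1), IsOfHodgeType 2 S (2 * 1) 2 0 τ →
      ∃ t : ℂ, τ = t • LinearEquiv.symm η x)) ∧
    (k3Form x x = 0 ∧ 0 < (k3Form (star x) x).re ∧
      ∃ u : K3Index → ℤ, k3Form (fun i => (u i : ℂ)) x = 0 ∧ 0 < ∑ i, ∑ j, u i * k3Gram i j * u j))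

variable {S : SchemeOver ℂ}

/-- **The rational matrix of a rational endomorphism in a marking**: for a K3 surface `S` marked by `η`
(integral classes `↔ Λ`) and a `ℂ`-linear endomorphism `t` of `H²(S(ℂ); ℂ)` preserving rational classes, there
is a rational matrix `θ` with `η (t c) = θ_ℂ (η c)` for all `c` (rational classes are `Λ_ℚ` in the marking,
`isRationalClass_iff_of_marking`; `exists_ratEnd_of_forall_intCast`; two `ℂ`-linear maps agreeing on the
standard basis agree). [cite: Huybrechts2016K3, Ch. 6 Rem. 3.3] [cite: GeemenSchutt2023, §2.1] -/
theorem exists_ratMatrix_marking_conj (hS : IsK3Surface S) (η : complexBetti S (2 * 1) ≃ₗ[ℂ] (K3Index → ℂ))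
    (hηint : ∀ c : complexBetti S (2 * 1), IsIntegralClass c ↔ ∃ v : K3Index → ℤ, η c = fun i => (v i : ℂ))
    (t : complexBetti S (2 * 1) →ₗ[ℂ] complexBetti S (2 * 1))
    (ht_rat : ∀ y, IsRationalClass y → IsRationalClass (t y)) :
    ∃ θ : Matrix K3Index K3Index ℚ, ∀ c : complexBetti S (2 * 1), η (t c) = thetaC θ (η c) := by
  classical
  -- `ρ = η t η⁻¹` is defined over `ℚ`
  set ρ : Module.End ℂ (K3Index → ℂ) := η.toLinearMap ∘ₗ t ∘ₗ η.symm.toLinearMap with hρ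
  have hρrat : ∀ v : K3Index → ℤ, ∃ w : K3Index → ℚ, ρ (fun i => (v i : ℂ)) = fun i => (w i : ℂ) := by
    intro v
    have hint : IsIntegralClass (η.symm fun i => (v i : ℂ)) := (hηint _).2 ⟨v, η.apply_symm_apply _⟩
    obtain ⟨w, hw⟩ := (isRationalClass_iff_of_marking hS η hηint _).1 (ht_rat _ hint.isRationalClass)
    exact ⟨w, by simpa [hρ] using hw⟩
  obtain ⟨τ, hτ⟩ := exists_ratEnd_of_forall_intCast ρ hρrat
  refine ⟨LinearMap.toMatrix' τ, fun c ↦ ?_⟩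
  -- `θ_ℂ = ρ`: both are `ℂ`-linear and agree on the standard basis
  have hbasis : ∀ j : K3Index, ρ (Pi.single j 1) = thetaC (LinearMap.toMatrix' τ) (Pi.single j 1) := by
    intro j
    have hcast : (fun i => ((Pi.single j (1 : ℚ) : K3Index → ℚ) i : ℂ)) = Pi.single j 1 := by
      funext i
      by_cases hij : i = j
      · subst hij; simp
      · simp [Pi.single_eq_of_ne hij]
    rw [← hcast, hτ, thetaC_ratCast, LinearMap.toMatrix'_mulVec]
  have heq : ρ = thetaC (LinearMap.toMatrix' τ) :=
    (Pi.basisFun ℂ K3Index).ext fun j ↦ by rw [Pi.basisFun_apply]; exact hbasis j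
  have h1 : η (t c) = ρ (η c) := by simp [hρ]
  rw [h1, heq]

/-- **«(D)(θ_{S,t}) ⇒ HC⁴(S ⊗ S)» — RM-type descent at `σ = id`** (planner p1 g36 NEXT-2): for an RM K3 surface
`S` (`IsRealMultiplicationK3 S ρ P`) marked by `(η, p, x)`, an admissible generator `t` of `End_Hdg T(S)` which is
SELF-ADJOINT for the cup form (`ht_sa`, read through the marking) and whose rational matrix in the marking is `θ`
(`hθ : η ∘ t = θ_ℂ ∘ η`, cf. `exists_ratMatrix_marking_conj`): if the rational type `θ` is dominated
(`RMTypeDominated θ`), then `HodgeConjectureFor 4 (S ⊗ S)` — `hodgeConjectureFor_square_of_rmTypeDominated` with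
`σ = id`. CONDITIONAL on {`Buskin2019_hodgeIsometry_algebraic`, `Huybrechts_K3_periodSurjective_projective`} and the
displayed `hDom`; credits nothing. [cite: GeemenSchutt2023, §3.4 and §4.8] [cite: Buskin2019, Thm. 1.1]
[cite: Huybrechts2016K3, Ch. 7 Thm. 4.1] -/
theorem hodgeConjectureFor_square_of_rmTypeDominated_self
    (hB : Buskin2019_hodgeIsometry_algebraic) (hPS : Huybrechts_K3_periodSurjective_projective)
    {S : SchemeOver ℂ} {ρ : ℕ} {P : ℚ[X]} (h : IsRealMultiplicationK3 S ρ P)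
    (η : complexBetti S (2 * 1) ≃ₗ[ℂ] (K3Index → ℂ)) (p : complexBetti S (2 * 2)) (x : K3Index → ℂ)
    (hM : MarkedK3[S, η, p, x])
    (t : complexBetti S (2 * 1) →ₗ[ℂ] complexBetti S (2 * 1))
    (ht_rat : ∀ y, IsRationalClass y → IsRationalClass (t y))
    (ht_typ : ∀ (i j : ℕ) (y : complexBetti S (2 * 1)),
      IsOfHodgeType 2 S (2 * 1) i j y → IsOfHodgeType 2 S (2 * 1) i j (t y))
    (ht_N : ∀ d ∈ algebraicClasses S 1, t d = 0)
    (ht_perp : ∀ (y : complexBetti S (2 * 1)), ∀ d ∈ algebraicClasses S 1,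
      cupProduct (rfl : 2 * 1 + 2 * 1 = 2 * 2) (t y) d = 0)
    (hP : IsAnnihilatedOnTranscendentalBy S t P) (hgen : TranscendentalEndomorphismsGeneratedBy S t)
    (ht_sa : ∀ a b : complexBetti S (2 * 1), k3Form (η (t a)) (η b) = k3Form (η a) (η (t b)))
    {θ : Matrix K3Index K3Index ℚ} (hθ : ∀ c : complexBetti S (2 * 1), η (t c) = thetaC θ (η c))
    (hDom : RMTypeDominated θ) :
    HodgeConjectureFor 4 (S ⊗ S) := by
  have hθsa : ∀ a b : K3Index → ℂ, k3Form (thetaC θ a) b = k3Form a (thetaC θ b) := by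
    intro a b
    have ha := hθ (η.symm a)
    have hb := hθ (η.symm b)
    rw [LinearEquiv.apply_symm_apply] at ha hb
    rw [← ha, ← hb]
    have h1 := ht_sa (η.symm a) (η.symm b)
    rwa [LinearEquiv.apply_symm_apply, LinearEquiv.apply_symm_apply] at h1
  exact hodgeConjectureFor_square_of_rmTypeDominated hB hPS hDom hθsa h η p x hM t ht_rat ht_typ ht_N ht_perp hP
    hgen LinearMap.id (fun _ _ ↦ rfl)
    (fun v ↦ ⟨fun i => (v i : ℚ), by rw [LinearMap.id_apply]; funext i; push_cast; rfl⟩)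
    (fun c ↦ by rw [LinearMap.id_apply, LinearMap.id_apply]; exact hθ c)

end Summit.HodgeConjecture.HodgeConjecture.Theorems.MarkmanPartnerTransport.RMTypeDescent

end
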